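import Summits.ResolutionOfSingularities.ResolutionOfSingularities.Theorems.FrobeniusLadderFInjectiveMacaulayficationTauFloorBXChartAlgebra
import Summits.ResolutionOfSingularities.ResolutionOfSingularities.Theorems.FrobeniusLadderFInjectiveMacaulayficationTauFloorF5YChartIdent
import Literature.AlgebraicGeometry.Resolution.AffineBlowupAlgebra
import HarnessLib

/-!
# (N2-X″) The tower `T₂ = k[x, y′, u′, w][t][z′]` IS the Rees chart `D(x̄)` of `Bl_τ(P2d4B)`: `T₂ ≃+* A₀[τ/x̄] = blowupAlgebra τ x̄`
# (crux `FInjectiveMacaulayfication` stmt-ResolutionOfSingularities-15315, chain w45a; res-L1-w45a-plan-1 g19 RULING R19.6 (3) «(N2) ROW #3 INPUT LEGALITY → stub-2»,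
# step (Y-b) of res-L1-w45a-stub-3 g10's (N1) TEMPLATE `…TauFloorF5YChartIdent`; seat res-L1-w45a-stub-2 g8)

[OURS · L1 W4.5a] Support file (`--supports stmt-ResolutionOfSingularities-15315 --as helper`); replaces the role of NO printed item; NOT a statement of
any manuscript; def-free; UNCONDITIONAL; characteristic-free (any field `k`). AI-written (AI review is weaker than expert review).

`A₀ = k[X0..X4]/(f)`, `f = X4² + X0²X4 + X1³ + X2³ + X3⁵` (P2d4B, `x,y,u,t,z = X0..X4`), `τ = Ideal.span {x̄, ȳ, ū, t̄², z̄}` (row #3, p630677), the tower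
`T₂ = AdjoinRoot h₂` over `AdjoinRoot h₁` over `B₀ = k[x, y′, u′, w]` of `…TauFloorBXChartAlgebra` (p634333).
* §1 ring identities + ★ `exists_chartMap` — the CHART MAP `φ : T₂ → A₀[1/x̄]`, `x, y′, u′, w, t, z′ ↦ x̄, ȳ/x̄, ū/x̄, t̄²/x̄, t̄, z̄/x̄`, obtained from the
  UNIVERSAL PROPERTY `TauFloorBXChartAlgebra.exists_towerLift` (the two tower relations hold in `A₀[1/x̄]` because `f̄ = 0` and `x̄·(1/x̄) = 1`);
  ★ `exists_blowdownMap` — the BLOW-DOWN MAP `ψ₁ : A₀ → T₂`, `x̄, ȳ, ū, t̄, z̄ ↦ x, xy′, xu′, t, xz′` (kills `f`: `f(x, xy′, xu′, t, xz′) = x²·h₂(z′) + t(t²+xw)(t²−xw)`);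
* §2 ★ `chartMap_injective` — `ψ₁` extended to `A₀[1/x̄] → T₂[1/x]` inverts `φ` after `T₂ → T₂[1/x]`, which is injective because `x` is a NON-ZERO-DIVISOR of `T₂`
  (`TauFloorBXChartAlgebra.algebraMap_X0_mem_nonZeroDivisors`, flatness over `B₀`);
* §3 ★★ `exists_chartEquiv` — `∃ e : T₂ ≃+* blowupAlgebra τ x̄` with the generator values of `φ` (range `⊆`: `TauFloorF5YChartIdent.adjoinRoot_subring_eq_top` BY NAME
  on the generators; `⊇`: the range is an `A₀`-subalgebra containing `g/x̄` for the five generators `g` of `τ`, `Algebra.adjoin_le`).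
Consequence for (N2): the CM clause (p634333 `cmCl_localization`) and the NON-FULL prime `𝔮 = (x̄, t̄, w̄, z̄′)` (`…TauFloorBXChartNotFull`) transport to the
`D(x̄)` chart of `Bl_τ(P2d4B)` along `e` (next file, pattern p623233 `…TauFloorOneChartXTransport`). [cite: GortzWedhorn2020, (13.19) p. 415] [cite: StacksProject, Tag 0804]
-/

-- single-problem summit: the doubled namespace component is forced
set_option linter.dupNamespace false
-- `Localization.Away (Ideal.Quotient.mk (Ideal.span {f}) (X 0))`: instance search through the Ore-localization `DistribMulAction A₀ A₀` goal is SLOW for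
-- this spelling of the chart element (it succeeds; the default 20000 is not enough — measured on `f_rel_away` alone); the spelling is kept because it is the
-- one the row files (p630078/p630677) and `LocalBlowupInputFromCharts` use for the generator `x̄` of `τ`.
set_option synthInstance.maxHeartbeats 400000

noncomputable section

namespace Summit.ResolutionOfSingularities.ResolutionOfSingularities.Theorems.FInjectiveMacaulayfication.TauFloorBXChartIdent

open MvPolynomial IsLocalization Literature.AlgebraicGeometry.Resolution
open Summit.ResolutionOfSingularities.ResolutionOfSingularities.Theorems.FInjectiveMacaulayfication
open TauFloorBXChartAlgebra

variable (k : Type) [Field k]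

/-! ## §1 The chart map `φ : T₂ → A₀[1/x̄]` and the blow-down map `ψ₁ : A₀ → T₂` -/

/-- `T² = x·(T²·i)` when `x·i = 1`. [ring identity] -/
theorem ident_t {L : Type} [CommRing L] (x T i : L) (hxi : x * i = 1) : T ^ 2 = x * (T ^ 2 * i) := by
  linear_combination (-(T ^ 2)) * hxi

/-- `h₂(z·i) = 0` in `A₀[1/x̄]`: `(zi)² + x(zi) + (x((yi)³ + (ui)³) + T(T²i)²) = 0` when `z² + x²z + y³ + u³ + T⁵ = 0` and `x·i = 1`. [ring identity] -/
theorem ident_z {L : Type} [CommRing L] (x y u T z i : L) (hF : z ^ 2 + x ^ 2 * z + y ^ 3 + u ^ 3 + T ^ 5 = 0) (hxi : x * i = 1) :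
    (z * i) ^ 2 + x * (z * i) + (x * ((y * i) ^ 3 + (u * i) ^ 3) + T * (T ^ 2 * i) ^ 2) = 0 := by
  linear_combination (i ^ 2) * hF + (-(x * z * i) + y ^ 3 * i ^ 2 + u ^ 3 * i ^ 2) * hxi

/-- `f(x, xy′, xu′, t, xz′) = x²·(z′² + xz′ + x(y′³+u′³) + tw²)` modulo `t² = xw`. [ring identity] -/
theorem ident_blowdown {T : Type} [CommRing T] (x y u w t z : T) (ht : t ^ 2 = x * w)
    (hz : z ^ 2 = -(x * z + x * (y ^ 3 + u ^ 3) + t * w ^ 2)) :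
    (x * z) ^ 2 + x ^ 2 * (x * z) + (x * y) ^ 3 + (x * u) ^ 3 + t ^ 5 = 0 := by
  linear_combination (x ^ 2) * hz + (t * (t ^ 2 + x * w)) * ht

/-- `f̄ = 0` read in `A₀[1/x̄]`, expanded. [plumbing] -/
theorem f_rel_away (f : MvPolynomial (Fin 5) k) (hf : f = X 4 ^ 2 + X 0 ^ 2 * X 4 + X 1 ^ 3 + X 2 ^ 3 + X 3 ^ 5) :
    algebraMap (MvPolynomial (Fin 5) k ⧸ Ideal.span {f}) (Localization.Away (Ideal.Quotient.mk (Ideal.span {f}) (X 0) : MvPolynomial (Fin 5) k ⧸ Ideal.span {f})) (Ideal.Quotient.mk (Ideal.span {f}) (X 4)) ^ 2 +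
      algebraMap (MvPolynomial (Fin 5) k ⧸ Ideal.span {f}) (Localization.Away (Ideal.Quotient.mk (Ideal.span {f}) (X 0) : MvPolynomial (Fin 5) k ⧸ Ideal.span {f})) (Ideal.Quotient.mk (Ideal.span {f}) (X 0)) ^ 2 *
        algebraMap (MvPolynomial (Fin 5) k ⧸ Ideal.span {f}) (Localization.Away (Ideal.Quotient.mk (Ideal.span {f}) (X 0) : MvPolynomial (Fin 5) k ⧸ Ideal.span {f})) (Ideal.Quotient.mk (Ideal.span {f}) (X 4)) +
      algebraMap (MvPolynomial (Fin 5) k ⧸ Ideal.span {f}) (Localization.Away (Ideal.Quotient.mk (Ideal.span {f}) (X 0) : MvPolynomial (Fin 5) k ⧸ Ideal.span {f})) (Ideal.Quotient.mk (Ideal.span {f}) (X 1)) ^ 3 +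
      algebraMap (MvPolynomial (Fin 5) k ⧸ Ideal.span {f}) (Localization.Away (Ideal.Quotient.mk (Ideal.span {f}) (X 0) : MvPolynomial (Fin 5) k ⧸ Ideal.span {f})) (Ideal.Quotient.mk (Ideal.span {f}) (X 2)) ^ 3 +
      algebraMap (MvPolynomial (Fin 5) k ⧸ Ideal.span {f}) (Localization.Away (Ideal.Quotient.mk (Ideal.span {f}) (X 0) : MvPolynomial (Fin 5) k ⧸ Ideal.span {f})) (Ideal.Quotient.mk (Ideal.span {f}) (X 3)) ^ 5 = 0 := by
  have h0 : Ideal.Quotient.mk (Ideal.span {f}) (X 4 ^ 2 + X 0 ^ 2 * X 4 + X 1 ^ 3 + X 2 ^ 3 + X 3 ^ 5 : MvPolynomial (Fin 5) k) = 0 := by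
    rw [← hf]; exact Ideal.Quotient.eq_zero_iff_mem.mpr (Ideal.mem_span_singleton_self f)
  have h1 := congrArg (algebraMap (MvPolynomial (Fin 5) k ⧸ Ideal.span {f}) (Localization.Away (Ideal.Quotient.mk (Ideal.span {f}) (X 0) : MvPolynomial (Fin 5) k ⧸ Ideal.span {f}))) h0
  rw [map_zero] at h1
  simpa only [map_add, map_mul, map_pow] using h1

/-- ★ **THE CHART MAP `φ : T₂ → A₀[1/x̄]`** (`x, y′, u′, w ↦ x̄, ȳ/x̄, ū/x̄, t̄²/x̄`, `t ↦ t̄`, `z′ ↦ z̄/x̄`) exists — by the universal property of the tower.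
[cite: GortzWedhorn2020, (13.19) p. 415] -/
theorem exists_chartMap (f : MvPolynomial (Fin 5) k) (hf : f = X 4 ^ 2 + X 0 ^ 2 * X 4 + X 1 ^ 3 + X 2 ^ 3 + X 3 ^ 5)
    (h₁ : Polynomial (MvPolynomial (Fin 4) k)) (hh₁ : h₁ = Polynomial.X ^ 2 - Polynomial.C (X 0 * X 3))
    (h₂ : Polynomial (AdjoinRoot h₁))
    (hh₂ : h₂ = Polynomial.X ^ 2 + (Polynomial.C (algebraMap (MvPolynomial (Fin 4) k) (AdjoinRoot h₁) (X 0)) * Polynomial.X +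
      Polynomial.C (algebraMap (MvPolynomial (Fin 4) k) (AdjoinRoot h₁) (X 0 * (X 1 ^ 3 + X 2 ^ 3)) +
        AdjoinRoot.root h₁ * algebraMap (MvPolynomial (Fin 4) k) (AdjoinRoot h₁) (X 3 ^ 2)))) :
    ∃ φ : AdjoinRoot h₂ →+* Localization.Away (Ideal.Quotient.mk (Ideal.span {f}) (X 0) : MvPolynomial (Fin 5) k ⧸ Ideal.span {f}),
      (∀ a : k, φ (algebraMap (MvPolynomial (Fin 4) k) (AdjoinRoot h₂) (C a)) = algebraMap (MvPolynomial (Fin 5) k ⧸ Ideal.span {f}) _ (Ideal.Quotient.mk (Ideal.span {f}) (C a))) ∧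
      (∀ i : Fin 4, φ (algebraMap (MvPolynomial (Fin 4) k) (AdjoinRoot h₂) (X i)) =
        ![algebraMap (MvPolynomial (Fin 5) k ⧸ Ideal.span {f}) _ (Ideal.Quotient.mk (Ideal.span {f}) (X 0)), algebraMap (MvPolynomial (Fin 5) k ⧸ Ideal.span {f}) _ (Ideal.Quotient.mk (Ideal.span {f}) (X 1)) * Away.invSelf (Ideal.Quotient.mk (Ideal.span {f}) (X 0)), algebraMap (MvPolynomial (Fin 5) k ⧸ Ideal.span {f}) _ (Ideal.Quotient.mk (Ideal.span {f}) (X 2)) * Away.invSelf (Ideal.Quotient.mk (Ideal.span {f}) (X 0)),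
          algebraMap (MvPolynomial (Fin 5) k ⧸ Ideal.span {f}) _ (Ideal.Quotient.mk (Ideal.span {f}) (X 3)) ^ 2 * Away.invSelf (Ideal.Quotient.mk (Ideal.span {f}) (X 0))] i) ∧
      φ (AdjoinRoot.of h₂ (AdjoinRoot.root h₁)) = algebraMap (MvPolynomial (Fin 5) k ⧸ Ideal.span {f}) _ (Ideal.Quotient.mk (Ideal.span {f}) (X 3)) ∧
      φ (AdjoinRoot.root h₂) = algebraMap (MvPolynomial (Fin 5) k ⧸ Ideal.span {f}) _ (Ideal.Quotient.mk (Ideal.span {f}) (X 4)) * Away.invSelf (Ideal.Quotient.mk (Ideal.span {f}) (X 0)) := by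
  classical
  let mkA : MvPolynomial (Fin 5) k →+* MvPolynomial (Fin 5) k ⧸ Ideal.span {f} := Ideal.Quotient.mk (Ideal.span {f})
  let L := Localization.Away (mkA (X 0))
  let ι : (MvPolynomial (Fin 5) k ⧸ Ideal.span {f}) →+* L := algebraMap _ _
  let inv : L := Away.invSelf (mkA (X 0))
  have hxi : ι (mkA (X 0)) * inv = 1 := Away.mul_invSelf (S := L) (mkA (X 0))
  let v : Fin 4 → L := ![ι (mkA (X 0)), ι (mkA (X 1)) * inv, ι (mkA (X 2)) * inv, ι (mkA (X 3)) ^ 2 * inv]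
  let g : MvPolynomial (Fin 4) k →+* L := eval₂Hom (ι.comp (mkA.comp MvPolynomial.C)) v
  have hgX : ∀ i, g (X i) = v i := fun i => eval₂Hom_X' _ _ i
  have hF := f_rel_away k f hf
  obtain ⟨φ, hφB, hφt, hφz⟩ : ∃ φ : AdjoinRoot h₂ →+* L, φ.comp (algebraMap (MvPolynomial (Fin 4) k) (AdjoinRoot h₂)) = g ∧
      φ (AdjoinRoot.of h₂ (AdjoinRoot.root h₁)) = ι (mkA (X 3)) ∧ φ (AdjoinRoot.root h₂) = ι (mkA (X 4)) * inv := by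
    refine exists_towerLift (S := L) k h₁ hh₁ h₂ hh₂ g (ι (mkA (X 3))) (ι (mkA (X 4)) * inv) ?_ ?_
    · rw [hgX, hgX]
      exact ident_t _ _ _ hxi
    · rw [hgX, hgX, hgX, hgX]
      exact ident_z _ _ _ _ _ _ hF hxi
  refine ⟨φ, fun a => ?_, fun i => ?_, hφt, hφz⟩
  · have h := RingHom.congr_fun hφB (C a)
    rw [RingHom.comp_apply] at h
    rw [h]
    exact eval₂Hom_C _ _ a
  · have h := RingHom.congr_fun hφB (X i)
    rw [RingHom.comp_apply] at h
    rw [h, hgX]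

/-- ★ **THE BLOW-DOWN MAP `ψ₁ : A₀ → T₂`** (`x̄, ȳ, ū, t̄, z̄ ↦ x, xy′, xu′, t, xz′`): it kills `f` by `ident_blowdown` and the two tower relations. [folklore] -/
theorem exists_blowdownMap (f : MvPolynomial (Fin 5) k) (hf : f = X 4 ^ 2 + X 0 ^ 2 * X 4 + X 1 ^ 3 + X 2 ^ 3 + X 3 ^ 5)
    (h₁ : Polynomial (MvPolynomial (Fin 4) k)) (hh₁ : h₁ = Polynomial.X ^ 2 - Polynomial.C (X 0 * X 3))
    (h₂ : Polynomial (AdjoinRoot h₁))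
    (hh₂ : h₂ = Polynomial.X ^ 2 + (Polynomial.C (algebraMap (MvPolynomial (Fin 4) k) (AdjoinRoot h₁) (X 0)) * Polynomial.X +
      Polynomial.C (algebraMap (MvPolynomial (Fin 4) k) (AdjoinRoot h₁) (X 0 * (X 1 ^ 3 + X 2 ^ 3)) +
        AdjoinRoot.root h₁ * algebraMap (MvPolynomial (Fin 4) k) (AdjoinRoot h₁) (X 3 ^ 2)))) :
    ∃ ψ₁ : (MvPolynomial (Fin 5) k ⧸ Ideal.span {f}) →+* AdjoinRoot h₂,
      (∀ j : Fin 5, ψ₁ (Ideal.Quotient.mk (Ideal.span {f}) (X j)) =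
        ![algebraMap (MvPolynomial (Fin 4) k) (AdjoinRoot h₂) (X 0), algebraMap (MvPolynomial (Fin 4) k) (AdjoinRoot h₂) (X 0) * algebraMap (MvPolynomial (Fin 4) k) (AdjoinRoot h₂) (X 1), algebraMap (MvPolynomial (Fin 4) k) (AdjoinRoot h₂) (X 0) * algebraMap (MvPolynomial (Fin 4) k) (AdjoinRoot h₂) (X 2), AdjoinRoot.of h₂ (AdjoinRoot.root h₁), algebraMap (MvPolynomial (Fin 4) k) (AdjoinRoot h₂) (X 0) * AdjoinRoot.root h₂] j) ∧
      ∀ a : k, ψ₁ (Ideal.Quotient.mk (Ideal.span {f}) (C a)) = algebraMap (MvPolynomial (Fin 4) k) (AdjoinRoot h₂) (C a) := by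
  let aM : MvPolynomial (Fin 4) k →+* AdjoinRoot h₂ := algebraMap (MvPolynomial (Fin 4) k) (AdjoinRoot h₂)
  let u : Fin 5 → AdjoinRoot h₂ := ![algebraMap (MvPolynomial (Fin 4) k) (AdjoinRoot h₂) (X 0), algebraMap (MvPolynomial (Fin 4) k) (AdjoinRoot h₂) (X 0) * algebraMap (MvPolynomial (Fin 4) k) (AdjoinRoot h₂) (X 1), algebraMap (MvPolynomial (Fin 4) k) (AdjoinRoot h₂) (X 0) * algebraMap (MvPolynomial (Fin 4) k) (AdjoinRoot h₂) (X 2), AdjoinRoot.of h₂ (AdjoinRoot.root h₁), algebraMap (MvPolynomial (Fin 4) k) (AdjoinRoot h₂) (X 0) * AdjoinRoot.root h₂]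
  have hf0 : eval₂Hom (aM.comp MvPolynomial.C) u f = 0 := by
    rw [hf]
    simp only [map_add, map_mul, map_pow, eval₂Hom_X']
    exact ident_blowdown _ _ _ (aM (X 3)) _ _ (t_sq_eq k h₁ hh₁ h₂) (z_sq_eq k h₁ h₂ hh₂)
  refine ⟨Ideal.Quotient.lift (Ideal.span {f}) (eval₂Hom (aM.comp MvPolynomial.C) u) ?_, fun j => ?_, fun a => ?_⟩
  · intro a ha
    obtain ⟨c, rfl⟩ := Ideal.mem_span_singleton.mp ha
    rw [map_mul, hf0, zero_mul]
  · rw [Ideal.Quotient.lift_mk]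
    exact eval₂Hom_X' _ _ j
  · rw [Ideal.Quotient.lift_mk]
    exact eval₂Hom_C _ _ a

/-! ## §2 The chart map is injective -/

set_option maxHeartbeats 800000 in
-- one `IsLocalization` lift + a generator-by-generator comparison of two ring maps out of the tower
/-- ★ **The chart map `φ : T₂ → A₀[1/x̄]` is injective**: with `ψ : A₀[1/x̄] → T₂[1/x]` the extension of the blow-down map, `ψ ∘ φ = (T₂ → T₂[1/x])`
(checked on `k`, `x, y′, u′, w`, `t`, `z′`), and `T₂ → T₂[1/x]` is injective since `x` is a non-zero-divisor of the FLAT `B₀`-algebra `T₂`. [folklore] -/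
theorem chartMap_injective (f : MvPolynomial (Fin 5) k) (hf : f = X 4 ^ 2 + X 0 ^ 2 * X 4 + X 1 ^ 3 + X 2 ^ 3 + X 3 ^ 5)
    (h₁ : Polynomial (MvPolynomial (Fin 4) k)) (hh₁ : h₁ = Polynomial.X ^ 2 - Polynomial.C (X 0 * X 3))
    (h₂ : Polynomial (AdjoinRoot h₁))
    (hh₂ : h₂ = Polynomial.X ^ 2 + (Polynomial.C (algebraMap (MvPolynomial (Fin 4) k) (AdjoinRoot h₁) (X 0)) * Polynomial.X +
      Polynomial.C (algebraMap (MvPolynomial (Fin 4) k) (AdjoinRoot h₁) (X 0 * (X 1 ^ 3 + X 2 ^ 3)) +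
        AdjoinRoot.root h₁ * algebraMap (MvPolynomial (Fin 4) k) (AdjoinRoot h₁) (X 3 ^ 2))))
    (φ : AdjoinRoot h₂ →+* Localization.Away (Ideal.Quotient.mk (Ideal.span {f}) (X 0) : MvPolynomial (Fin 5) k ⧸ Ideal.span {f}))
    (hφC : ∀ a : k, φ (algebraMap (MvPolynomial (Fin 4) k) (AdjoinRoot h₂) (C a)) = algebraMap (MvPolynomial (Fin 5) k ⧸ Ideal.span {f}) _ (Ideal.Quotient.mk (Ideal.span {f}) (C a)))
    (hφX : ∀ i : Fin 4, φ (algebraMap (MvPolynomial (Fin 4) k) (AdjoinRoot h₂) (X i)) =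
        ![algebraMap (MvPolynomial (Fin 5) k ⧸ Ideal.span {f}) _ (Ideal.Quotient.mk (Ideal.span {f}) (X 0)), algebraMap (MvPolynomial (Fin 5) k ⧸ Ideal.span {f}) _ (Ideal.Quotient.mk (Ideal.span {f}) (X 1)) * Away.invSelf (Ideal.Quotient.mk (Ideal.span {f}) (X 0)), algebraMap (MvPolynomial (Fin 5) k ⧸ Ideal.span {f}) _ (Ideal.Quotient.mk (Ideal.span {f}) (X 2)) * Away.invSelf (Ideal.Quotient.mk (Ideal.span {f}) (X 0)),
          algebraMap (MvPolynomial (Fin 5) k ⧸ Ideal.span {f}) _ (Ideal.Quotient.mk (Ideal.span {f}) (X 3)) ^ 2 * Away.invSelf (Ideal.Quotient.mk (Ideal.span {f}) (X 0))] i)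
    (hφt : φ (AdjoinRoot.of h₂ (AdjoinRoot.root h₁)) = algebraMap (MvPolynomial (Fin 5) k ⧸ Ideal.span {f}) _ (Ideal.Quotient.mk (Ideal.span {f}) (X 3)))
    (hφz : φ (AdjoinRoot.root h₂) = algebraMap (MvPolynomial (Fin 5) k ⧸ Ideal.span {f}) _ (Ideal.Quotient.mk (Ideal.span {f}) (X 4)) * Away.invSelf (Ideal.Quotient.mk (Ideal.span {f}) (X 0))) :
    Function.Injective φ := by
  classical
  let mkA : MvPolynomial (Fin 5) k →+* MvPolynomial (Fin 5) k ⧸ Ideal.span {f} := Ideal.Quotient.mk (Ideal.span {f})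
  let L := Localization.Away (mkA (X 0))
  let ι : (MvPolynomial (Fin 5) k ⧸ Ideal.span {f}) →+* L := algebraMap _ _
  let inv : L := Away.invSelf (mkA (X 0))
  let aM : MvPolynomial (Fin 4) k →+* AdjoinRoot h₂ := algebraMap (MvPolynomial (Fin 4) k) (AdjoinRoot h₂)
  let xT : AdjoinRoot h₂ := aM (X 0)
  -- `x` is a non-zero-divisor of `T₂`, so `T₂ → T₂[1/x]` is injective
  have hx : xT ∈ nonZeroDivisors (AdjoinRoot h₂) := algebraMap_X0_mem_nonZeroDivisors k h₁ hh₁ h₂ hh₂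
  let LT := Localization.Away xT
  let ιT : AdjoinRoot h₂ →+* LT := algebraMap _ _
  have hιT_inj : Function.Injective ιT :=
    IsLocalization.injective LT (M := Submonoid.powers xT) ((Submonoid.powers_le (P := nonZeroDivisors _)).mpr hx)
  -- the blow-down map and its extension `ψ : A₀[1/x̄] → T₂[1/x]`
  obtain ⟨ψ₁, hψX, hψC⟩ := exists_blowdownMap k f hf h₁ hh₁ h₂ hh₂
  have hψx : ψ₁ (mkA (X 0)) = xT := hψX 0
  have hunit : IsUnit ((ιT.comp ψ₁) (mkA (X 0))) := by
    rw [RingHom.comp_apply, hψx]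
    exact IsLocalization.Away.algebraMap_isUnit xT
  let ψ : L →+* LT := IsLocalization.Away.lift (mkA (X 0)) hunit
  have hψι : ∀ a, ψ (ι a) = ιT (ψ₁ a) := fun a => IsLocalization.Away.lift_eq (mkA (X 0)) hunit a
  have hψi : ψ inv * ιT xT = 1 := by
    have h1 : ψ inv * ψ (ι (mkA (X 0))) = 1 := by
      rw [← map_mul, mul_comm, Away.mul_invSelf, map_one]
    rwa [hψι, hψx] at h1
  -- generic cancellation: `ιT (x c) · ψ inv = ιT c`
  have hcan : ∀ c : AdjoinRoot h₂, ιT (xT * c) * ψ inv = ιT c := fun c => by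
    rw [map_mul, mul_comm (ιT xT), mul_assoc, mul_comm (ιT xT), hψi, mul_one]
  -- `ψ ∘ φ = ιT`
  have hcomp : ψ.comp φ = ιT := by
    refine tower₂_ringHom_ext k h₁ h₂ (MvPolynomial.ringHom_ext (fun a => ?_) (fun i => ?_)) ?_ ?_
    · change ψ (φ (aM (C a))) = ιT (aM (C a))
      rw [hφC, hψι, hψC]
    · change ψ (φ (aM (X i))) = ιT (aM (X i))
      rw [hφX]
      fin_cases i
      · change ψ (ι (mkA (X 0))) = ιT (aM (X 0))
        rw [hψι, hψx]
      · change ψ (ι (mkA (X 1)) * inv) = ιT (aM (X 1))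
        rw [map_mul, hψι, hψX 1]
        exact hcan (aM (X 1))
      · change ψ (ι (mkA (X 2)) * inv) = ιT (aM (X 2))
        rw [map_mul, hψι, hψX 2]
        exact hcan (aM (X 2))
      · change ψ (ι (mkA (X 3)) ^ 2 * inv) = ιT (aM (X 3))
        rw [map_mul, map_pow, hψι, hψX 3]
        change ιT (AdjoinRoot.of h₂ (AdjoinRoot.root h₁)) ^ 2 * ψ inv = ιT (aM (X 3))
        rw [← map_pow ιT, t_sq_eq k h₁ hh₁ h₂]
        exact hcan (aM (X 3))
    · rw [RingHom.comp_apply, hφt, hψι, hψX 3]; rfl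
    · rw [RingHom.comp_apply, hφz, map_mul, hψι, hψX 4]
      exact hcan (AdjoinRoot.root h₂)
  have h2 : Function.Injective (⇑ψ ∘ ⇑φ) := by rw [← RingHom.coe_comp, hcomp]; exact hιT_inj
  exact h2.of_comp

/-! ## §3 ★★ `T₂ ≃ A₀[τ/x̄]` -/

set_option maxHeartbeats 1600000 in
-- generator bookkeeping on both sides (as in `TauFloorF5YChartIdent.exists_chartEquiv`)
/-- ★★ **The tower `T₂` is the Rees chart `D(x̄)` of `Bl_τ X`**: a ring isomorphism `e : T₂ ≃+* blowupAlgebra τ x̄` with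
`x, y′, u′, w, t, z′ ↦ x̄, ȳ/x̄, ū/x̄, t̄²/x̄, t̄, z̄/x̄` (values in `A₀[1/x̄]`). [cite: GortzWedhorn2020, (13.19) p. 415] -/
theorem exists_chartEquiv (f : MvPolynomial (Fin 5) k) (hf : f = X 4 ^ 2 + X 0 ^ 2 * X 4 + X 1 ^ 3 + X 2 ^ 3 + X 3 ^ 5)
    (h₁ : Polynomial (MvPolynomial (Fin 4) k)) (hh₁ : h₁ = Polynomial.X ^ 2 - Polynomial.C (X 0 * X 3))
    (h₂ : Polynomial (AdjoinRoot h₁))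
    (hh₂ : h₂ = Polynomial.X ^ 2 + (Polynomial.C (algebraMap (MvPolynomial (Fin 4) k) (AdjoinRoot h₁) (X 0)) * Polynomial.X +
      Polynomial.C (algebraMap (MvPolynomial (Fin 4) k) (AdjoinRoot h₁) (X 0 * (X 1 ^ 3 + X 2 ^ 3)) +
        AdjoinRoot.root h₁ * algebraMap (MvPolynomial (Fin 4) k) (AdjoinRoot h₁) (X 3 ^ 2)))) :
    ∃ e : AdjoinRoot h₂ ≃+* blowupAlgebra (Ideal.span {Ideal.Quotient.mk (Ideal.span {f}) (X 0), Ideal.Quotient.mk (Ideal.span {f}) (X 1), Ideal.Quotient.mk (Ideal.span {f}) (X 2), Ideal.Quotient.mk (Ideal.span {f}) (X 3) ^ 2, Ideal.Quotient.mk (Ideal.span {f}) (X 4)} : Ideal (MvPolynomial (Fin 5) k ⧸ Ideal.span {f})) (Ideal.Quotient.mk (Ideal.span {f}) (X 0)),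
      (∀ a : k, ((e (algebraMap (MvPolynomial (Fin 4) k) (AdjoinRoot h₂) (C a)) : blowupAlgebra _ (Ideal.Quotient.mk (Ideal.span {f}) (X 0))) : Localization.Away (Ideal.Quotient.mk (Ideal.span {f}) (X 0) : MvPolynomial (Fin 5) k ⧸ Ideal.span {f})) = algebraMap (MvPolynomial (Fin 5) k ⧸ Ideal.span {f}) _ (Ideal.Quotient.mk (Ideal.span {f}) (C a))) ∧
      (∀ i : Fin 4, ((e (algebraMap (MvPolynomial (Fin 4) k) (AdjoinRoot h₂) (X i)) : blowupAlgebra _ (Ideal.Quotient.mk (Ideal.span {f}) (X 0))) : Localization.Away (Ideal.Quotient.mk (Ideal.span {f}) (X 0) : MvPolynomial (Fin 5) k ⧸ Ideal.span {f})) =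
        ![algebraMap (MvPolynomial (Fin 5) k ⧸ Ideal.span {f}) _ (Ideal.Quotient.mk (Ideal.span {f}) (X 0)), algebraMap (MvPolynomial (Fin 5) k ⧸ Ideal.span {f}) _ (Ideal.Quotient.mk (Ideal.span {f}) (X 1)) * Away.invSelf (Ideal.Quotient.mk (Ideal.span {f}) (X 0)), algebraMap (MvPolynomial (Fin 5) k ⧸ Ideal.span {f}) _ (Ideal.Quotient.mk (Ideal.span {f}) (X 2)) * Away.invSelf (Ideal.Quotient.mk (Ideal.span {f}) (X 0)),
          algebraMap (MvPolynomial (Fin 5) k ⧸ Ideal.span {f}) _ (Ideal.Quotient.mk (Ideal.span {f}) (X 3)) ^ 2 * Away.invSelf (Ideal.Quotient.mk (Ideal.span {f}) (X 0))] i) ∧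
      ((e (AdjoinRoot.of h₂ (AdjoinRoot.root h₁)) : blowupAlgebra _ (Ideal.Quotient.mk (Ideal.span {f}) (X 0))) : Localization.Away (Ideal.Quotient.mk (Ideal.span {f}) (X 0) : MvPolynomial (Fin 5) k ⧸ Ideal.span {f})) = algebraMap (MvPolynomial (Fin 5) k ⧸ Ideal.span {f}) _ (Ideal.Quotient.mk (Ideal.span {f}) (X 3)) ∧
      ((e (AdjoinRoot.root h₂) : blowupAlgebra _ (Ideal.Quotient.mk (Ideal.span {f}) (X 0))) : Localization.Away (Ideal.Quotient.mk (Ideal.span {f}) (X 0) : MvPolynomial (Fin 5) k ⧸ Ideal.span {f})) = algebraMap (MvPolynomial (Fin 5) k ⧸ Ideal.span {f}) _ (Ideal.Quotient.mk (Ideal.span {f}) (X 4)) * Away.invSelf (Ideal.Quotient.mk (Ideal.span {f}) (X 0)) := by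
  classical
  obtain ⟨φ, hφC, hφX, hφt, hφz⟩ := exists_chartMap k f hf h₁ hh₁ h₂ hh₂
  have hinj := chartMap_injective k f hf h₁ hh₁ h₂ hh₂ φ hφC hφX hφt hφz
  obtain ⟨ψ₁, hψX, hψC⟩ := exists_blowdownMap k f hf h₁ hh₁ h₂ hh₂
  -- abbreviations (terms only)
  let mkA : MvPolynomial (Fin 5) k →+* MvPolynomial (Fin 5) k ⧸ Ideal.span {f} := Ideal.Quotient.mk (Ideal.span {f})
  let τ : Ideal (MvPolynomial (Fin 5) k ⧸ Ideal.span {f}) := Ideal.span {mkA (X 0), mkA (X 1), mkA (X 2), mkA (X 3) ^ 2, mkA (X 4)}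
  let L := Localization.Away (mkA (X 0))
  let B : Subalgebra (MvPolynomial (Fin 5) k ⧸ Ideal.span {f}) L := blowupAlgebra τ (mkA (X 0))
  let ι : (MvPolynomial (Fin 5) k ⧸ Ideal.span {f}) →+* L := algebraMap _ _
  let inv : L := Away.invSelf (mkA (X 0))
  let aM : MvPolynomial (Fin 4) k →+* AdjoinRoot h₂ := algebraMap (MvPolynomial (Fin 4) k) (AdjoinRoot h₂)
  have hxi : ι (mkA (X 0)) * inv = 1 := Away.mul_invSelf (S := L) (mkA (X 0))
  -- (1) `φ ∘ ψ₁ = ι`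
  have hφψ : φ.comp ψ₁ = ι := by
    refine Ideal.Quotient.ringHom_ext (MvPolynomial.ringHom_ext (fun a => ?_) (fun j => ?_))
    · change φ (ψ₁ (mkA (C a))) = ι (mkA (C a))
      rw [hψC, hφC]
    · change φ (ψ₁ (mkA (X j))) = ι (mkA (X j))
      rw [hψX]
      fin_cases j
      · exact hφX 0
      · change φ (aM (X 0) * aM (X 1)) = ι (mkA (X 1))
        rw [map_mul, hφX 0, hφX 1]
        change ι (mkA (X 0)) * (ι (mkA (X 1)) * inv) = ι (mkA (X 1))
        rw [mul_comm, mul_assoc, mul_comm inv, hxi, mul_one]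
      · change φ (aM (X 0) * aM (X 2)) = ι (mkA (X 2))
        rw [map_mul, hφX 0, hφX 2]
        change ι (mkA (X 0)) * (ι (mkA (X 2)) * inv) = ι (mkA (X 2))
        rw [mul_comm, mul_assoc, mul_comm inv, hxi, mul_one]
      · exact hφt
      · change φ (aM (X 0) * AdjoinRoot.root h₂) = ι (mkA (X 4))
        rw [map_mul, hφX 0, hφz]
        change ι (mkA (X 0)) * (ι (mkA (X 4)) * inv) = ι (mkA (X 4))
        rw [mul_comm, mul_assoc, mul_comm inv, hxi, mul_one]
  have hι_mem : ∀ a, ι a ∈ φ.range := fun a => ⟨ψ₁ a, by rw [← RingHom.comp_apply, hφψ]⟩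
  -- (2) `range φ ⊆ B`: every generator of the tower lands in `B`
  have hB₀ : ∀ b : MvPolynomial (Fin 4) k, φ (aM b) ∈ B := by
    intro b
    induction b using MvPolynomial.induction_on with
    | C a => rw [hφC]; exact B.algebraMap_mem _
    | add p q hp hq => rw [map_add, map_add]; exact B.add_mem hp hq
    | mul_X p i hp =>
      rw [map_mul, map_mul]
      refine B.mul_mem hp ?_
      rw [hφX]
      fin_cases i
      · exact B.algebraMap_mem (mkA (X 0))
      · change ι (mkA (X 1)) * inv ∈ B
        exact div_mem_blowupAlgebra τ (mkA (X 0)) (Ideal.subset_span (by simp))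
      · change ι (mkA (X 2)) * inv ∈ B
        exact div_mem_blowupAlgebra τ (mkA (X 0)) (Ideal.subset_span (by simp))
      · change ι (mkA (X 3)) ^ 2 * inv ∈ B
        rw [← map_pow ι]
        exact div_mem_blowupAlgebra τ (mkA (X 0)) (Ideal.subset_span (by simp))
  have hrange_le : ∀ c, φ c ∈ B := by
    -- level 1, level 2 via `adjoinRoot_subring_eq_top`
    have l1 : ∀ x : AdjoinRoot h₁, (φ.comp (AdjoinRoot.of h₂)) x ∈ B := by
      refine TauFloorF5YChartIdent.adjoinRoot_subring_eq_top h₁ (B.toSubring.comap (φ.comp (AdjoinRoot.of h₂))) (fun b => ?_) ?_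
      · change φ (AdjoinRoot.of h₂ (AdjoinRoot.of h₁ b)) ∈ B
        rw [← algebraMap_tower_apply]; exact hB₀ b
      · change φ (AdjoinRoot.of h₂ (AdjoinRoot.root h₁)) ∈ B
        rw [hφt]; exact B.algebraMap_mem _
    refine TauFloorF5YChartIdent.adjoinRoot_subring_eq_top h₂ (B.toSubring.comap φ) (fun b => l1 b) ?_
    change φ (AdjoinRoot.root h₂) ∈ B
    rw [hφz]
    change ι (mkA (X 4)) * inv ∈ B
    exact div_mem_blowupAlgebra τ (mkA (X 0)) (Ideal.subset_span (by simp))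
  -- (3) `B ⊆ range φ`: the range is an `A₀`-subalgebra containing the generators `g/x̄`, `g ∈ τ`
  let Rφ : Subalgebra (MvPolynomial (Fin 5) k ⧸ Ideal.span {f}) L :=
    { carrier := φ.range
      mul_mem' := fun ha hb => φ.range.mul_mem ha hb
      one_mem' := φ.range.one_mem
      add_mem' := fun ha hb => φ.range.add_mem ha hb
      zero_mem' := φ.range.zero_mem
      algebraMap_mem' := fun a => hι_mem a }
  have hgens : blowupAlgebraGens τ (mkA (X 0)) ⊆ (Rφ : Set L) := by
    rintro _ ⟨g, hg, rfl⟩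
    change ι g * inv ∈ φ.range
    refine Submodule.span_induction (p := fun g _ => ι g * inv ∈ φ.range) ?_ ?_ ?_ ?_ hg
    · intro g hg
      simp only [Set.mem_insert_iff, Set.mem_singleton_iff] at hg
      rcases hg with rfl | rfl | rfl | rfl | rfl
      · exact ⟨1, by rw [map_one, hxi]⟩
      · exact ⟨aM (X 1), hφX 1⟩
      · exact ⟨aM (X 2), hφX 2⟩
      · exact ⟨aM (X 3), by rw [hφX 3, map_pow ι]; rfl⟩
      · exact ⟨AdjoinRoot.root h₂, hφz⟩
    · rw [map_zero, zero_mul]; exact φ.range.zero_mem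
    · intro a b _ _ ha hb
      rw [map_add, add_mul]; exact φ.range.add_mem ha hb
    · intro r a _ ha
      rw [smul_eq_mul, map_mul, mul_assoc]; exact φ.range.mul_mem (hι_mem r) ha
  have hle_range : B ≤ Rφ := Algebra.adjoin_le hgens
  -- (4) the equivalence
  have hsurj : Function.Surjective (φ.codRestrict B.toSubring fun c => hrange_le c) := by
    intro b
    obtain ⟨c, hc⟩ := (hle_range b.2 : (b : L) ∈ φ.range)
    exact ⟨c, Subtype.ext hc⟩
  have hinj' : Function.Injective (φ.codRestrict B.toSubring fun c => hrange_le c) := fun a b h =>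
    hinj (congrArg Subtype.val h)
  exact ⟨RingEquiv.ofBijective (φ.codRestrict B.toSubring fun c => hrange_le c) ⟨hinj', hsurj⟩, hφC, hφX, hφt, hφz⟩

end Summit.ResolutionOfSingularities.ResolutionOfSingularities.Theorems.FInjectiveMacaulayfication.TauFloorBXChartIdent

end
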